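import Mathlib.Analysis.InnerProductSpace.PiL2
import Mathlib.Analysis.Calculus.Gradient.Basic
import Mathlib.Analysis.SpecialFunctions.Trigonometric.Basic
import Mathlib.MeasureTheory.Measure.Hausdorff
import Mathlib.MeasureTheory.Measure.Haar.InnerProductSpace
import Mathlib.MeasureTheory.Measure.WithDensity
import Mathlib.MeasureTheory.Integral.Bochner.Basic
import Mathlib.MeasureTheory.Function.LpSeminorm.Basic
import Mathlib.GroupTheory.SpecificGroups.Dihedral
import HarnessLib

/-!
# Kohn–Luttinger / weak-coupling BCS data on the square lattice

Topic `Literature/MathematicalPhysics/QuantumLattice` (definition item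
`defn-Literature.QLattice.kohnLuttingerKernel`, route `HubbardSuperconductivity/WeakCouplingBCS`,
crux #3 `stmt-…-0158`, a certified-computation item).

For a band dispersion `ε : 𝕋² → ℝ` (a `2π`-periodic function on momentum space
`ℝ² = EuclideanSpace ℝ (Fin 2)`, e.g. the square-lattice `ε(k) = -2t(cos k₀ + cos k₁) - 4t' cos k₀ cos k₁`)
and a chemical potential `μ`, the weak-coupling (`U → 0`) theory of superconductivity in the
Hubbard model (Kohn–Luttinger 1965; Raghu–Kivelson–Scalapino 2010, §II–III) is governed by an
eigenvalue problem for an integral kernel on the Fermi curve. We define the data of that problem: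

* `brillouinZone = [-π, π)²`, `fermiCurve ε μ = {k ∈ BZ | ε k = μ}`;
* `fermiCurveMeasure ε μ` — arc length on the Fermi curve weighted by `1/|∇ε|` (the density-of-
  states measure `dk̂ / v_F(k̂)` of RKS eqs. (6), (8)): the 1-dimensional Hausdorff measure `μH[1]`
  restricted to the Fermi curve, `withDensity (‖∇ε‖⁻¹)`;
* `fermiOccupation ε μ p = f(ε p) = 𝟙[ε p < μ]` (zero temperature), `filling ε μ = n(μ)`
  (electrons per site, both spins, RKS eq. (4)) and `chemicalPotentialOfDensity ε n`;
* `lindhardFunction ε μ q = χ(q) = ∫_{BZ} (f(ε p) - f(ε (p+q))) / (ε (p+q) - ε p) dp/(2π)²` — the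
  static `T = 0` susceptibility of the free band (RKS eq. (5); at `T = 0` the integrand vanishes
  identically where numerator and denominator vanish together, so no principal value is needed);
* `kohnLuttingerKernel ε μ U k k' = U + U² χ(k + k')` — the second-order singlet pairing vertex
  (Kohn–Luttinger 1965; RKS eq. (7): `ρU²[χ(k̂+q̂) + c₁]` in the `1/v_F`-weighted measure);
* the point group `D₄` of the square lattice acting on momenta (`d4Momentum`, Mathlib
  `DihedralGroup 4`, same convention as `d4Site` of `PairCorrelations.lean`), the characters of its
  irreducible representations `A₁g, A₂g, B₁g, B₂g, E` (`D4Irrep`, `D4Irrep.char`), the isotypic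
  projections `d4Project χ ψ` on functions on momentum space (RKS eq. (17));
* `pairingForm ε μ U ψ = ∫∫ ψ(k) Γ(k,k') ψ(k') dμ_F dμ_F` and
  `channelInf ε μ U χ = inf {pairingForm ψ | ψ ∈ L²(FS, μ_F) real, d4Project χ ψ = ψ, ‖ψ‖₂ = 1}` —
  the bottom of the pairing vertex in the symmetry channel `χ`; the physical channel is the one
  with the most negative value (RKS §II, eqs. (7), (13)).

## Design choices

* Momentum space is `EuclideanSpace ℝ (Fin 2)` (not `Fin 2 → ℝ`), so that `‖∇ε‖`, `gradient` and
  the Hausdorff measure `μH[1]` (arc length) refer to the Euclidean metric.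
* Everything is stated for an arbitrary `ε`; periodicity/regularity are hypotheses consumers add.
  `squareDispersion t t'` is provided as the standard example.
* Bochner integrals return the junk value `0` for non-integrable integrands (e.g. `χ` exactly at a
  nesting vector of a perfectly nested Fermi surface, where it diverges logarithmically);
  `channelInf` is an `sInf` in `ℝ` (junk `0` if the admissible set were empty or unbounded below —
  it is neither for bounded `Γ` on a nonempty Fermi curve). Documented, as usual for
  certified-computation vocabulary.
* `D₄` is Mathlib's `DihedralGroup 4` acting on momenta exactly as `Literature.MathematicalPhysics.QuantumLattice.d4Site` acts on
  sites (`r i ↦ rotⁱ`, `sr i ↦ refl ∘ rotⁱ`); characters are the character table as explicit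
  functions (`B₁g` agrees with the existing complex-valued `b1gChar`); every element of `D₄` is
  conjugate to its inverse, so `∑_γ χ(γ) ψ(γ k)` is the isotypic projector up to `dim χ / 8`.
* Mathlib: `gradient`, `μH[1]`, `Measure.withDensity`, `MemLp`, Bochner integral, `Real.cos`;
  no Fermi surfaces / Lindhard function / point-group channels (searched `Lindhard`, `fermi`,
  `KohnLuttinger`).

## References

* W. Kohn, J. M. Luttinger, *New mechanism for superconductivity*, Phys. Rev. Lett. 15 (1965)
  524–526.
* S. Raghu, S. A. Kivelson, D. J. Scalapino, *Superconductivity in the repulsive Hubbard model: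
  an asymptotically exact weak-coupling solution*, Phys. Rev. B 81 (2010) 224505
  (arXiv:1002.0591), §II eqs. (4)–(9), (13), §III eq. (17).
-/

noncomputable section

open MeasureTheory Real
open scoped ENNReal

namespace Literature.MathematicalPhysics.QuantumLattice

/-- Momentum space `ℝ²` of the square lattice (Euclidean metric). [folklore] -/
abbrev Momentum : Type := EuclideanSpace ℝ (Fin 2)

/-- The square-lattice tight-binding dispersion with nearest (`t`) and next-nearest (`t'`)
neighbour hopping: `ε(k) = -2t (cos k₀ + cos k₁) - 4t' cos k₀ cos k₁`.
[cite: RaghuKivelsonScalapino2010, §III] -/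
def squareDispersion (t t' : ℝ) (k : Momentum) : ℝ :=
  -2 * t * (cos (k 0) + cos (k 1)) - 4 * t' * cos (k 0) * cos (k 1)

/-- The (half-open) first Brillouin zone `[-π, π)²`. [cite: RaghuKivelsonScalapino2010, §II (5)] -/
def brillouinZone : Set Momentum :=
  {k | ∀ i, k i ∈ Set.Ico (-π) π}

/-- The **Fermi curve** `{k ∈ BZ | ε(k) = μ}` of the dispersion `ε` at chemical potential `μ`.
[cite: RaghuKivelsonScalapino2010, §II] -/
def fermiCurve (ε : Momentum → ℝ) (μ : ℝ) : Set Momentum :=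
  {k ∈ brillouinZone | ε k = μ}

/-- The **Fermi-curve (density-of-states) measure** `dk̂ / v_F(k̂)`: arc length (`μH[1]`) on the
Fermi curve weighted by the inverse Fermi speed `‖∇ε(k)‖⁻¹` (junk weight `0⁻¹ = 0` at critical
points of `ε`, i.e. van Hove points, a null set generically). Integrating `1` gives `(2π)² ρ`, the
density of states at the Fermi level (RKS eq. (6)); RKS eq. (8) is its normalised form.
[cite: RaghuKivelsonScalapino2010, §II (6) and (8)] -/
def fermiCurveMeasure (ε : Momentum → ℝ) (μ : ℝ) : Measure Momentum :=
  ((Measure.hausdorffMeasure 1).restrict (fermiCurve ε μ)).withDensity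
    fun k => ENNReal.ofReal (‖gradient ε k‖⁻¹)

/-- Zero-temperature Fermi occupation `f(ε(p)) = 𝟙[ε(p) < μ]`. [cite: RaghuKivelsonScalapino2010, §II (5)] -/
def fermiOccupation (ε : Momentum → ℝ) (μ : ℝ) (p : Momentum) : ℝ :=
  if ε p < μ then 1 else 0

/-- The **filling** (electron density per site, both spin species, `0 ≤ n ≤ 2`):
`n(μ) = 2 ∫_{BZ} 𝟙[ε(p) < μ] dp / (2π)²` (RKS eq. (4) for the free band at `T = 0`).
[cite: RaghuKivelsonScalapino2010, §II (4)] -/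
def KohnLuttinger.filling (ε : Momentum → ℝ) (μ : ℝ) : ℝ :=
  2 * (∫ p in brillouinZone, fermiOccupation ε μ p) / (2 * π) ^ 2

/-- The chemical potential realising the density `n`: `μ(n) = inf {μ | n ≤ n(μ)}` (the filling is
monotone in `μ`; `sInf` junk value `0` if `n > 2`). [cite: RaghuKivelsonScalapino2010, §II (4)] -/
def chemicalPotentialOfDensity (ε : Momentum → ℝ) (n : ℝ) : ℝ :=
  sInf {μ | n ≤ KohnLuttinger.filling ε μ}

/-- The zero-temperature Lindhard integrand `(f(ε p) - f(ε (p+q))) / (ε (p+q) - ε p)`, set to `0`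
where the two occupations agree (there the quotient is `0/·` or the removable `0/0`); where they
differ the denominator is non-zero. Always `≥ 0`. [cite: RaghuKivelsonScalapino2010, §II (5)] -/
def lindhardIntegrand (ε : Momentum → ℝ) (μ : ℝ) (q p : Momentum) : ℝ :=
  if fermiOccupation ε μ p = fermiOccupation ε μ (p + q) then 0
  else (fermiOccupation ε μ p - fermiOccupation ε μ (p + q)) / (ε (p + q) - ε p)

/-- The **static Lindhard function** (free-band susceptibility at `T = 0`)
`χ(q) = ∫_{BZ} (f(ε p) - f(ε (p+q))) / (ε (p+q) - ε p) dp / (2π)²`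
`= -∫ (f(ε_{p+q}) - f(ε_p)) / (ε_{p+q} - ε_p)` (RKS eq. (5)); `χ(q) → ρ` as `q → 0` (RKS eq. (6)).
Bochner integral: junk `0` where the integrand is not integrable (perfect nesting).
[cite: RaghuKivelsonScalapino2010, §II (5)] -/
def lindhardFunction (ε : Momentum → ℝ) (μ : ℝ) (q : Momentum) : ℝ :=
  (∫ p in brillouinZone, lindhardIntegrand ε μ q p) / (2 * π) ^ 2

/-- The **Kohn–Luttinger kernel** (second-order spin-singlet pairing vertex of the Hubbard model)
`Γ(k, k') = U + U² χ(k + k')` on the Fermi curve, to be read as an integral operator on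
`L²(fermiCurve, fermiCurveMeasure)` (Kohn–Luttinger 1965; RKS eq. (7), where the bare `U` appears
as `ρU² c₁` and the `1/v_F` weights are absorbed in the measure).
[cite: RaghuKivelsonScalapino2010, §II (7)] -/
def kohnLuttingerKernel (ε : Momentum → ℝ) (μ U : ℝ) (k k' : Momentum) : ℝ :=
  U + U ^ 2 * lindhardFunction ε μ (k + k')

/-! ### The point group `D₄` and its symmetry channels -/

/-- Rotation of momentum space by `π/2`: `(k₀, k₁) ↦ (-k₁, k₀)` (same convention as
`Literature.MathematicalPhysics.QuantumLattice.rotSite` of `PairCorrelations.lean`). [folklore] -/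
def rotMomentum (k : Momentum) : Momentum := WithLp.toLp 2 ![-k 1, k 0]

/-- Reflection of momentum space in the `k₀`-axis: `(k₀, k₁) ↦ (k₀, -k₁)` (same convention as
`Literature.MathematicalPhysics.QuantumLattice.reflSite`). [folklore] -/
def reflMomentum (k : Momentum) : Momentum := WithLp.toLp 2 ![k 0, -k 1]

/-- The action of the point group `D₄ = ⟨r, s⟩` of the square lattice (Mathlib `DihedralGroup 4`,
`sr i = s rⁱ`) on momenta: `r i ↦ rotⁱ`, `sr i ↦ refl ∘ rotⁱ` — verbatim the convention of
`Literature.MathematicalPhysics.QuantumLattice.d4Site` (real-space sites) transported to momentum space.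
[cite: RaghuKivelsonScalapino2010, §III (17)] -/
def d4Momentum : DihedralGroup 4 → Momentum → Momentum
  | DihedralGroup.r i, k => rotMomentum^[i.val] k
  | DihedralGroup.sr i, k => reflMomentum (rotMomentum^[i.val] k)

/-- The irreducible representations of `D₄` relevant for pairing on the square lattice:
`A₁g ∼ 1, x²+y²` (s-wave), `A₂g ∼ xy(x²-y²)` (g-wave), `B₁g ∼ x²-y²` (`d_{x²-y²}`),
`B₂g ∼ xy` (`d_{xy}`), and the two-dimensional `E ∼ {x, y}` (p-wave, triplet).
[cite: RaghuKivelsonScalapino2010, §III (17)] -/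
inductive D4Irrep
  | A1g | A2g | B1g | B2g | E
  deriving DecidableEq, Fintype

namespace D4Irrep

/-- Dimensions of the irreducible representations of `D₄`. [cite: RaghuKivelsonScalapino2010, §III (17)] -/
def dim : D4Irrep → ℕ
  | A1g => 1 | A2g => 1 | B1g => 1 | B2g => 1 | E => 2

/-- The (real) character table of `D₄` on `DihedralGroup 4` (`r i` = rotation by `iπ/2`,
`sr i = s rⁱ`, `s` = reflection in the `k₀`-axis, so `sr 0, sr 2` are the axis reflections and
`sr 1, sr 3` the diagonal ones): `A₁g ≡ 1`; `A₂g` is `+1` on rotations, `-1` on reflections;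
`B₁g(r i) = B₁g(sr i) = (-1)^i` (as `Literature.MathematicalPhysics.QuantumLattice.b1gChar`); `B₂g(r i) = (-1)^i`,
`B₂g(sr i) = -(-1)^i`; `E(1) = 2`, `E(r²) = -2`, `0` elsewhere. [folklore] -/
def char : D4Irrep → DihedralGroup 4 → ℝ
  | A1g, _ => 1
  | A2g, DihedralGroup.r _ => 1
  | A2g, DihedralGroup.sr _ => -1
  | B1g, DihedralGroup.r i => (-1) ^ i.val
  | B1g, DihedralGroup.sr i => (-1) ^ i.val
  | B2g, DihedralGroup.r i => (-1) ^ i.val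
  | B2g, DihedralGroup.sr i => -(-1) ^ i.val
  | E, DihedralGroup.r i => if i = 0 then 2 else if i = 2 then -2 else 0
  | E, DihedralGroup.sr _ => 0

end D4Irrep

/-- The isotypic projection onto the `χ`-channel of a function on momentum space:
`(P_χ ψ)(k) = (dim χ / 8) ∑_{γ ∈ D₄} χ(γ) ψ(γ k)` (real characters; each `γ` is conjugate to `γ⁻¹`
in `D₄`, so this is `(dim χ/|D₄|) ∑_γ χ(γ) (γ · ψ)` with `(γ · ψ)(k) = ψ(γ⁻¹ k)`).
[cite: RaghuKivelsonScalapino2010, §III (17)] -/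
def d4Project (χ : D4Irrep) (ψ : Momentum → ℝ) (k : Momentum) : ℝ :=
  (χ.dim / 8 : ℝ) * ∑ γ : DihedralGroup 4, χ.char γ * ψ (d4Momentum γ k)

/-- `ψ` lies in the symmetry channel `χ` (transforms in the irrep `χ` of `D₄`) iff it is fixed by
the isotypic projection. [cite: RaghuKivelsonScalapino2010, §III (17)] -/
def InChannel (χ : D4Irrep) (ψ : Momentum → ℝ) : Prop :=
  d4Project χ ψ = ψ

/-! ### The pairing eigenvalue problem -/

/-- The quadratic form of the Kohn–Luttinger kernel on `L²(fermiCurve, fermiCurveMeasure)`: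
`⟨ψ, Γ ψ⟩ = ∫∫ ψ(k) Γ(k, k') ψ(k') dμ_F(k) dμ_F(k')`. [cite: RaghuKivelsonScalapino2010, §II (7)] -/
def pairingForm (ε : Momentum → ℝ) (μ U : ℝ) (ψ : Momentum → ℝ) : ℝ :=
  ∫ k, ψ k * ∫ k', kohnLuttingerKernel ε μ U k k' * ψ k' ∂fermiCurveMeasure ε μ
    ∂fermiCurveMeasure ε μ

/-- Admissible normalised gap functions in the channel `χ`: real, square integrable on the Fermi
curve, of unit `L²(μ_F)`-norm, and transforming in the irrep `χ`. [cite: RaghuKivelsonScalapino2010, §II–III] -/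
def IsChannelState (ε : Momentum → ℝ) (μ : ℝ) (χ : D4Irrep) (ψ : Momentum → ℝ) : Prop :=
  MemLp ψ 2 (fermiCurveMeasure ε μ) ∧ (∫ k, ψ k ^ 2 ∂fermiCurveMeasure ε μ) = 1 ∧ InChannel χ ψ

/-- **Channel bottom of the pairing vertex**: `inf ⟨ψ, Γ ψ⟩` over normalised gap functions `ψ` in
the symmetry channel `χ` — the most negative pairing eigenvalue `λ₀(χ)` in that channel; the
superconducting instability occurs in the channel minimising it, with
`T_c ∼ W exp(-1/|λ₀|)` (RKS eqs. (7), (12)–(13)). `sInf` in `ℝ` (junk `0` on an empty or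
unbounded-below set). [cite: RaghuKivelsonScalapino2010, §II (7) and (13)] -/
def channelInf (ε : Momentum → ℝ) (μ U : ℝ) (χ : D4Irrep) : ℝ :=
  sInf ((pairingForm ε μ U) '' {ψ | IsChannelState ε μ χ ψ})

/-! ### Basic API -/

/-- The kernel is symmetric: `Γ(k, k') = Γ(k', k)`. [cite: KohnLuttinger1965] -/
theorem kohnLuttingerKernel_comm (ε : Momentum → ℝ) (μ U : ℝ) (k k' : Momentum) :
    kohnLuttingerKernel ε μ U k k' = kohnLuttingerKernel ε μ U k' k := by
  rw [kohnLuttingerKernel, kohnLuttingerKernel, add_comm k k']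

/-- At `U = 0` the pairing vertex vanishes. [cite: KohnLuttinger1965] -/
@[simp] theorem kohnLuttingerKernel_zero (ε : Momentum → ℝ) (μ : ℝ) (k k' : Momentum) :
    kohnLuttingerKernel ε μ 0 k k' = 0 := by
  simp [kohnLuttingerKernel]

/-- The Lindhard integrand is non-negative (`f` is antitone in the energy).
[cite: RaghuKivelsonScalapino2010, §II (5)] -/
theorem lindhardIntegrand_nonneg (ε : Momentum → ℝ) (μ : ℝ) (q p : Momentum) :
    0 ≤ lindhardIntegrand ε μ q p := by
  unfold lindhardIntegrand
  split_ifs with h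
  · exact le_rfl
  · unfold fermiOccupation at h ⊢
    by_cases h1 : ε p < μ <;> by_cases h2 : ε (p + q) < μ
    · exact absurd (by rw [if_pos h1, if_pos h2]) h
    · rw [if_pos h1, if_neg h2]
      exact div_nonneg (by norm_num) (by linarith [le_of_not_gt h2])
    · rw [if_neg h1, if_pos h2]
      have : ε (p + q) - ε p ≤ 0 := by linarith [le_of_not_gt h1]
      exact div_nonneg_iff.2 (Or.inr ⟨by norm_num, this⟩)
    · exact absurd (by rw [if_neg h1, if_neg h2]) h

/-- The Lindhard function is non-negative. [cite: RaghuKivelsonScalapino2010, §II (5)] -/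
theorem lindhardFunction_nonneg (ε : Momentum → ℝ) (μ : ℝ) (q : Momentum) :
    0 ≤ lindhardFunction ε μ q :=
  div_nonneg (integral_nonneg fun p => lindhardIntegrand_nonneg ε μ q p) (by positivity)

/-- Points of the Fermi curve lie in the Brillouin zone and on the level set. [cite: RaghuKivelsonScalapino2010, §II] -/
theorem mem_fermiCurve_iff {ε : Momentum → ℝ} {μ : ℝ} {k : Momentum} :
    k ∈ fermiCurve ε μ ↔ k ∈ brillouinZone ∧ ε k = μ :=
  Iff.rfl

/-- The identity element of `D₄` acts trivially. [folklore] -/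
@[simp] theorem d4Momentum_one (k : Momentum) : d4Momentum 1 k = k := by
  rw [DihedralGroup.one_def]
  simp [d4Momentum]

/-- The `A₁g` character is trivial, so `d4Project A1g` is the average over the orbit.
[folklore] -/
theorem d4Project_A1g (ψ : Momentum → ℝ) (k : Momentum) :
    d4Project .A1g ψ k = (1 / 8 : ℝ) * ∑ γ : DihedralGroup 4, ψ (d4Momentum γ k) := by
  simp [d4Project, D4Irrep.char, D4Irrep.dim]

/-- Constant gap functions are `s`-wave: they are fixed by the `A₁g` projector (uses `|D₄| = 8`,
i.e. that the normalisation `dim χ / 8` is right). [cite: RaghuKivelsonScalapino2010, §III (17)] -/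
theorem inChannel_A1g_const (c : ℝ) : InChannel .A1g (fun _ : Momentum => c) := by
  funext k
  rw [d4Project_A1g]
  simp [Finset.sum_const, Finset.card_univ, DihedralGroup.card]

end Literature.MathematicalPhysics.QuantumLattice

end
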